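import Summits.ABC.ABC.Theses.IsogenyGlueCongruence
import Literature.NumberTheory.DiophantineGeometry.PastenValuationProducts

/-!
# Crux-ideate sketches — `PolyDegreeOfBoundedPrimes` (stmt-ABC-2046), round 1, ideator 1

First lemmas of the three idea cards (`smooth-part-law`, `steinberg-selmer-cutoff`,
`eisenstein-slice-semistable`). Everything is stated over existing declarations
(`ModularParametrizationData.modularDegree`, `WeierstrassCurve.conductorNorm`,
`WeierstrassCurve.minimalDiscriminantNorm`, `valuationProduct`,
`pasten_valuationProduct_semistable`, the route decls `DegreePrimesPolyBounded`,
`PolyDegreeOfBoundedPrimes`). Sorry-free (standard axioms): the glue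
`SmoothPartLaw → PolyDegreeOfBoundedPrimes` is PROVED (this is exactly where hypothesis A of the
crux is consumed: A is the CUTOFF), and so is the composition of the two slices with Pasten's
valuation-product theorem, `IrreducibleCutoffLaw → EisensteinSliceBound →
pasten_valuationProduct_semistable → PolyDegreeOfBoundedPrimes`.
-/

noncomputable section

-- `Summit.<Summit>.<Problem>`: for the single-conjunct summit `ABC` the duplicate `ABC.ABC` is mandated.
set_option linter.dupNamespace false

open Literature.NumberTheory.EllipticCurves.ModularForms
open Literature.NumberTheory.DiophantineGeometry (valuationProduct pasten_valuationProduct_semistable)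
open Summit.ABC.ABC.Theses.IsogenyGlueCongruence

namespace Summit.ABC.ABC.Cruxes.PolyDegreeOfBoundedPrimes.Ideator1

/-! ## The smooth-part functional -/

/-- The `L`-smooth part of `n`: `∏_{p ≤ L} p^{v_p(n)}` (`= 1` for `n = 0` by the junk
convention of `Nat.factorization`). [folklore] -/
def smoothPart (L n : ℕ) : ℕ :=
  n.factorization.prod fun p e => if p ≤ L then p ^ e else 1

/-- The `(y, L]`-window part of `n`: `∏_{y < p ≤ L} p^{v_p(n)}`. [folklore] -/
def windowPart (y L n : ℕ) : ℕ :=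
  n.factorization.prod fun p e => if y < p ∧ p ≤ L then p ^ e else 1

/-- If every prime factor of `n ≠ 0` is `≤ L`, the `L`-smooth part of `n` is `n`. [folklore] -/
theorem smoothPart_eq_self {L n : ℕ} (hn : n ≠ 0) (h : ∀ p ∈ n.primeFactors, p ≤ L) :
    smoothPart L n = n := by
  unfold smoothPart
  conv_rhs => rw [← Nat.prod_factorization_pow_eq_self hn]
  apply Finsupp.prod_congr
  intro p hp
  rw [Nat.support_factorization] at hp
  simp [h p hp]

/-! ## Card 1 — `smooth-part-law` -/

/-- **SmoothPartLaw** (card `smooth-part-law`, the transfer target `C⁺`). For semistable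
globally-minimal elliptic `W/ℚ` of conductor `N`, below every modular parametrisation datum `D₀`
at level `N` there is a datum `D` (the minimal one) with `deg D ∣ deg D₀` whose `L`-SMOOTH PART
is at most `C · L^{κ₁} · N^{κ₂}` for EVERY cutoff `L ≥ 2`, with absolute `κ₁ ≥ 0, κ₂, C`.
It is implied by the polynomial degree conjecture `P` (take `κ₁ = 0`), it implies crux B
(`polyDegreeOfBoundedPrimes_of_smoothPartLaw`, proved: hypothesis A is the cutoff
`L = ⌈|C_A| N^κ⌉ + 2`), and it is strictly WEAKER than `P`: it allows degrees of size `e^{N}`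
provided their mass sits on primes of comparable size (consistent with the trivial bound
`log deg ≪ N log N` at `L = deg`). In deformation-theoretic terms (R = 𝕋, Wiles/Taylor–Wiles/
Diamond numerical criterion; ARS `r_E = m_E` for squarefree `N`) it says
`v_ℓ(m_E) ≤ length Sel_Σ(ℚ, ad⁰ρ_{E,ℓ} ⊗ ℚ_ℓ/ℤ_ℓ)` for the irreducible primes, so the law
FOLLOWS from a Brauer–Siegel-with-cutoff bound `Σ_{ℓ ≤ L} length Sel_Σ · log ℓ ≤ κ₁ log L + κ₂ log N + O(1)`
for the adjoint Selmer family of ONE curve, in which the congruence partners and their (giant)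
orbits do not appear. -/
def SmoothPartLaw : Prop :=
  ∃ κ₁ κ₂ C : ℝ, 0 ≤ κ₁ ∧ ∀ (W : WeierstrassCurve ℚ) [W.IsElliptic] [W.IsGloballyMinimal]
    [NeZero (W.conductorNorm ℤ)], W.IsSemistable ℤ →
    ∀ D₀ : ModularParametrizationData W (W.conductorNorm ℤ),
      ∃ D : ModularParametrizationData W (W.conductorNorm ℤ),
        D.modularDegree ∣ D₀.modularDegree ∧
        ∀ L : ℕ, 2 ≤ L →
          (smoothPart L D.modularDegree : ℝ) ≤
            C * (L : ℝ) ^ κ₁ * (W.conductorNorm ℤ : ℝ) ^ κ₂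

/-- **First lemma of card `smooth-part-law` (PROVED): `SmoothPartLaw → crux B`.** Hypothesis A
(`DegreePrimesPolyBounded`) supplies a datum `D_A` all of whose prime factors are
`≤ C_A N^κ ≤ L₀ := ⌈|C_A| N^κ⌉ + 2`; the law applied below `D_A` gives `D` with
`deg D ∣ deg D_A`, so `deg D` is `L₀`-smooth and `deg D = smoothPart L₀ (deg D) ≤ C L₀^{κ₁} N^{κ₂}
≤ C (|C_A|+3)^{κ₁} N^{max(κ,0) κ₁ + κ₂}`. This is the ONLY place A enters the line — as a
cutoff — in accordance with `Disproof.not_abstractPolyOfBoundedPrimes` (A alone is useless; it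
must be paired with depth × multiplicity arithmetic, which is what the law is). [folklore] -/
theorem polyDegreeOfBoundedPrimes_of_smoothPartLaw (hS : SmoothPartLaw) :
    PolyDegreeOfBoundedPrimes := by
  intro hA
  obtain ⟨κ₁, κ₂, C, hκ₁, hlaw⟩ := hS
  obtain ⟨κ, CA, hA⟩ := hA
  refine ⟨max κ 0 * κ₁ + κ₂, max C 0 * (|CA| + 3) ^ κ₁, ?_⟩
  intro W _ _ _ hW
  obtain ⟨DA, hDA⟩ := hA W hW
  obtain ⟨D, hdvd, hD⟩ := hlaw W hW DA
  set N : ℕ := W.conductorNorm ℤ with hN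
  have hN0 : (0 : ℝ) < N := by exact_mod_cast Nat.pos_of_ne_zero (NeZero.ne N)
  have hN1 : (1 : ℝ) ≤ N := by exact_mod_cast Nat.one_le_iff_ne_zero.mpr (NeZero.ne N)
  have hNκ0 : (0 : ℝ) ≤ (N : ℝ) ^ κ := Real.rpow_nonneg hN0.le κ
  set L₀ : ℕ := ⌈|CA| * (N : ℝ) ^ κ⌉₊ + 2 with hL₀
  have hL2 : 2 ≤ L₀ := by omega
  have hprimes : ∀ p ∈ (D.modularDegree).primeFactors, p ≤ L₀ := by
    intro p hp
    have hpP : p.Prime := Nat.prime_of_mem_primeFactors hp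
    have hpd : p ∣ D.modularDegree := Nat.dvd_of_mem_primeFactors hp
    have h1 : (p : ℝ) ≤ CA * (N : ℝ) ^ κ := hDA p hpP (hpd.trans hdvd)
    have h2 : (p : ℝ) ≤ |CA| * (N : ℝ) ^ κ :=
      h1.trans (mul_le_mul_of_nonneg_right (le_abs_self CA) hNκ0)
    have h3 : (p : ℝ) ≤ (⌈|CA| * (N : ℝ) ^ κ⌉₊ : ℝ) := h2.trans (Nat.le_ceil _)
    have h4 : p ≤ ⌈|CA| * (N : ℝ) ^ κ⌉₊ := by exact_mod_cast h3
    omega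
  have hsm : smoothPart L₀ D.modularDegree = D.modularDegree :=
    smoothPart_eq_self D.deg_pos.ne' hprimes
  have hb := hD L₀ hL2
  rw [hsm] at hb
  -- `L₀ ≤ (|CA| + 3) · N^{max κ 0}`
  have hNκ : (N : ℝ) ^ κ ≤ (N : ℝ) ^ (max κ 0) :=
    Real.rpow_le_rpow_of_exponent_le hN1 (le_max_left _ _)
  have hNκ1 : (1 : ℝ) ≤ (N : ℝ) ^ (max κ 0) := Real.one_le_rpow hN1 (le_max_right _ _)
  have hceil : (⌈|CA| * (N : ℝ) ^ κ⌉₊ : ℝ) < |CA| * (N : ℝ) ^ κ + 1 :=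
    Nat.ceil_lt_add_one (by positivity)
  have hL₀eq : (L₀ : ℝ) = (⌈|CA| * (N : ℝ) ^ κ⌉₊ : ℝ) + 2 := by
    rw [hL₀]; push_cast; ring
  have hL₀le : (L₀ : ℝ) ≤ (|CA| + 3) * (N : ℝ) ^ (max κ 0) := by
    rw [hL₀eq]
    have hm : |CA| * (N : ℝ) ^ κ ≤ |CA| * (N : ℝ) ^ (max κ 0) :=
      mul_le_mul_of_nonneg_left hNκ (abs_nonneg CA)
    nlinarith [abs_nonneg CA]
  have hL₀pos : (0 : ℝ) ≤ L₀ := by positivity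
  have hpow : (L₀ : ℝ) ^ κ₁ ≤ ((|CA| + 3) * (N : ℝ) ^ (max κ 0)) ^ κ₁ :=
    Real.rpow_le_rpow hL₀pos hL₀le hκ₁
  have hsplit : ((|CA| + 3) * (N : ℝ) ^ (max κ 0)) ^ κ₁ =
      (|CA| + 3) ^ κ₁ * (N : ℝ) ^ (max κ 0 * κ₁) := by
    rw [Real.mul_rpow (by positivity) (by positivity), ← Real.rpow_mul hN0.le]
  have hpow' : (L₀ : ℝ) ^ κ₁ ≤ (|CA| + 3) ^ κ₁ * (N : ℝ) ^ (max κ 0 * κ₁) :=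
    hpow.trans_eq hsplit
  have hC : C ≤ max C 0 := le_max_left _ _
  have hLκ₁ : (0 : ℝ) ≤ (L₀ : ℝ) ^ κ₁ := Real.rpow_nonneg hL₀pos κ₁
  have hNκ₂ : (0 : ℝ) ≤ (N : ℝ) ^ κ₂ := Real.rpow_nonneg hN0.le κ₂
  refine ⟨D, ?_⟩
  calc (D.modularDegree : ℝ) ≤ C * (L₀ : ℝ) ^ κ₁ * (N : ℝ) ^ κ₂ := hb
    _ ≤ max C 0 * (L₀ : ℝ) ^ κ₁ * (N : ℝ) ^ κ₂ :=
        mul_le_mul_of_nonneg_right (mul_le_mul_of_nonneg_right hC hLκ₁) hNκ₂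
    _ ≤ max C 0 * ((|CA| + 3) ^ κ₁ * (N : ℝ) ^ (max κ 0 * κ₁)) * (N : ℝ) ^ κ₂ :=
        mul_le_mul_of_nonneg_right (mul_le_mul_of_nonneg_left hpow' (le_max_right _ _)) hNκ₂
    _ = max C 0 * (|CA| + 3) ^ κ₁ * (N : ℝ) ^ (max κ 0 * κ₁ + κ₂) := by
        rw [Real.rpow_add hN0]; ring

/-! ## Card 3 — `eisenstein-slice-semistable` -/

/-- **EisensteinSliceBound** (card `eisenstein-slice-semistable`). For semistable `E/ℚ` the
residually REDUCIBLE primes are `ℓ ≤ 7` (Mazur 1978: `ρ̄_{E,ℓ}` irreducible for `ℓ ≥ 11`,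
semistable `E`), and `ℓ ∈ {2, 3}` are the solvable-image primes where the R = 𝕋 dictionary is
weakest; the card bets that the `7`-smooth part of the minimal modular degree is polynomial in
`N` (data: the `{2,3}`-part is `≈ N^{0.65–1.17}` on 39 Frey curves, refuter census
j000054/j000169 on DefiniteXi). A-free, but consumed by every line through B. -/
def EisensteinSliceBound : Prop :=
  ∃ κ C : ℝ, ∀ (W : WeierstrassCurve ℚ) [W.IsElliptic] [W.IsGloballyMinimal]
    [NeZero (W.conductorNorm ℤ)], W.IsSemistable ℤ →
    ∀ D₀ : ModularParametrizationData W (W.conductorNorm ℤ),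
      ∃ D : ModularParametrizationData W (W.conductorNorm ℤ),
        D.modularDegree ∣ D₀.modularDegree ∧
        (smoothPart 7 D.modularDegree : ℝ) ≤ C * (W.conductorNorm ℤ : ℝ) ^ κ

/-! ## Card 2 — `steinberg-selmer-cutoff` -/

/-- **IrreducibleCutoffLaw** (card `steinberg-selmer-cutoff`; arithmetic shadow of "cutoff
Brauer–Siegel for the Steinberg adjoint Selmer family"). For `ℓ ≥ 11` the `ℓ`-adic depth of the
minimal modular degree is `≤ length Sel_Σ(ℚ, ad⁰ρ_{E,ℓ} ⊗ ℚ_ℓ/ℤ_ℓ)`, `Σ = {p ∣ N : ℓ ∣ v_p(Δ_min)}`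
(Wiles–Taylor–Wiles–Diamond numerical criterion at DDT's level `N_Σ` + ARS `r_E = m_E` +
`r_E(N) ∣ r_E(N_Σ)`), and `Sel_Σ ⊇ Sel_St` (Böckle–Khare–Manning: Steinberg at every `p ∣ N`) with
quotient of length `≤ Σ_{p ∈ Σ} (2 v_ℓ(v_p(Δ_min)) + v_ℓ(p² − 1))` (local Euler characteristic +
local duality at the level-lowering primes; Ribet–Takahashi's `c_p = i_p j_p` is the geometric
face; any fixed power of the defect factor is absorbed into `κ₂` by Pasten's bound). So the level-lowering ("Tamagawa") mass is QUARANTINED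
into the explicit factor `T(W) = ∏_{p∣N} v_p(Δ_min) · (p²−1)`, which is polynomial in `N`
UNCONDITIONALLY (`pasten_valuationProduct_semistable`: `∏ v_p(Δ) < K_ε N^{11/2+ε}`; `∏(p²−1) ≤
N²`). The bet: the remaining all-new, residually irreducible mass in the window `7 < ℓ ≤ L` is
`≤ C L^{κ₁} N^{κ₂}`. Under A this is needed only for `L = C_A N^κ`. -/
def IrreducibleCutoffLaw : Prop :=
  ∃ κ₁ κ₂ C : ℝ, 0 ≤ κ₁ ∧ ∀ (W : WeierstrassCurve ℚ) [W.IsElliptic] [W.IsGloballyMinimal]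
    [NeZero (W.conductorNorm ℤ)], W.IsSemistable ℤ →
    ∀ D₀ : ModularParametrizationData W (W.conductorNorm ℤ),
      ∃ D : ModularParametrizationData W (W.conductorNorm ℤ),
        D.modularDegree ∣ D₀.modularDegree ∧
        ∀ L : ℕ, 2 ≤ L →
          (windowPart 7 L D.modularDegree : ℝ) ≤
            C * (L : ℝ) ^ κ₁ * (W.conductorNorm ℤ : ℝ) ^ κ₂ *
              (valuationProduct W * ∏ p ∈ (W.conductorNorm ℤ).primeFactors, (p ^ 2 - 1) : ℕ)

/-! ### Bookkeeping for the composition of the slices -/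

/-- `p^{v_p(n)} ≥ 1` (also at the junk values `p = 0, 1`). [folklore] -/
theorem one_le_pow_factorization (n p : ℕ) : 1 ≤ p ^ n.factorization p := by
  rcases Nat.eq_zero_or_pos p with rfl | hp
  · simp [Nat.factorization_zero_right]
  · exact Nat.one_le_pow _ _ hp

/-- The smooth part as a product over an initial segment. [folklore] -/
theorem smoothPart_eq_prod_range (L n : ℕ) :
    smoothPart L n = ∏ p ∈ Finset.range (L + 1), p ^ n.factorization p := by
  unfold smoothPart
  simp only [Finsupp.prod, Nat.support_factorization]
  rw [← Finset.prod_filter]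
  apply Finset.prod_subset
  · intro p hp
    rw [Finset.mem_filter] at hp
    exact Finset.mem_range.mpr (Nat.lt_succ_of_le hp.2)
  · intro p hpr hp
    have hpL : p ≤ L := Nat.le_of_lt_succ (Finset.mem_range.mp hpr)
    have hns : p ∉ n.primeFactors := fun h => hp (Finset.mem_filter.mpr ⟨h, hpL⟩)
    have h0 : n.factorization p = 0 := by
      apply Finsupp.notMem_support_iff.mp
      rwa [Nat.support_factorization]
    simp [h0]

/-- The window part as a product over an interval. [folklore] -/
theorem windowPart_eq_prod_Ioc (y L n : ℕ) :
    windowPart y L n = ∏ p ∈ Finset.Ioc y L, p ^ n.factorization p := by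
  unfold windowPart
  simp only [Finsupp.prod, Nat.support_factorization]
  rw [← Finset.prod_filter]
  apply Finset.prod_subset
  · intro p hp
    rw [Finset.mem_filter] at hp
    exact Finset.mem_Ioc.mpr hp.2
  · intro p hpr hp
    have hpL : y < p ∧ p ≤ L := Finset.mem_Ioc.mp hpr
    have hns : p ∉ n.primeFactors := fun h => hp (Finset.mem_filter.mpr ⟨h, hpL⟩)
    have h0 : n.factorization p = 0 := by
      apply Finsupp.notMem_support_iff.mp
      rwa [Nat.support_factorization]
    simp [h0]

/-- Products of `p^{v_p(n)}` are monotone in the index set. [folklore] -/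
theorem prod_pow_factorization_mono_set (n : ℕ) {s t : Finset ℕ} (h : s ⊆ t) :
    ∏ p ∈ s, p ^ n.factorization p ≤ ∏ p ∈ t, p ^ n.factorization p := by
  rw [← Finset.prod_sdiff h]
  have h1 : 1 ≤ ∏ p ∈ t \ s, p ^ n.factorization p := by
    rw [Nat.one_le_iff_ne_zero, Finset.prod_ne_zero_iff]
    intro p _
    exact Nat.one_le_iff_ne_zero.mp (one_le_pow_factorization n p)
  calc ∏ p ∈ s, p ^ n.factorization p = 1 * ∏ p ∈ s, p ^ n.factorization p := (one_mul _).symm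
    _ ≤ (∏ p ∈ t \ s, p ^ n.factorization p) * ∏ p ∈ s, p ^ n.factorization p :=
        Nat.mul_le_mul_right _ h1

/-- `[n]_L ≤ [n]_7 · window(7, L]`. [folklore] -/
theorem smoothPart_le_mul (L n : ℕ) : smoothPart L n ≤ smoothPart 7 n * windowPart 7 L n := by
  rw [smoothPart_eq_prod_range, smoothPart_eq_prod_range, windowPart_eq_prod_Ioc]
  by_cases hL : L ≤ 7
  · have hsub : Finset.range (L + 1) ⊆ Finset.range (7 + 1) := by
      intro x hx
      rw [Finset.mem_range] at hx ⊢
      omega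
    have h1 : 1 ≤ ∏ p ∈ Finset.Ioc 7 L, p ^ n.factorization p := by
      rw [Nat.one_le_iff_ne_zero, Finset.prod_ne_zero_iff]
      intro p _
      exact Nat.one_le_iff_ne_zero.mp (one_le_pow_factorization n p)
    calc ∏ p ∈ Finset.range (L + 1), p ^ n.factorization p
        ≤ ∏ p ∈ Finset.range (7 + 1), p ^ n.factorization p := prod_pow_factorization_mono_set n hsub
      _ = (∏ p ∈ Finset.range (7 + 1), p ^ n.factorization p) * 1 := (mul_one _).symm
      _ ≤ (∏ p ∈ Finset.range (7 + 1), p ^ n.factorization p) *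
            ∏ p ∈ Finset.Ioc 7 L, p ^ n.factorization p := Nat.mul_le_mul_left _ h1
  · have hunion : Finset.range (L + 1) = Finset.range (7 + 1) ∪ Finset.Ioc 7 L := by
      ext p
      simp only [Finset.mem_range, Finset.mem_union, Finset.mem_Ioc]
      omega
    have hdisj : Disjoint (Finset.range (7 + 1)) (Finset.Ioc 7 L) := by
      rw [Finset.disjoint_left]
      intro p hp hq
      simp only [Finset.mem_range] at hp
      simp only [Finset.mem_Ioc] at hq
      omega
    rw [hunion, Finset.prod_union hdisj]

/-- The window part is monotone under divisibility. [folklore] -/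
theorem windowPart_mono {y L a b : ℕ} (h : a ∣ b) (hb : b ≠ 0) :
    windowPart y L a ≤ windowPart y L b := by
  have ha : a ≠ 0 := by rintro rfl; exact hb (zero_dvd_iff.mp h)
  rw [windowPart_eq_prod_Ioc, windowPart_eq_prod_Ioc]
  apply Finset.prod_le_prod (fun _ _ => Nat.zero_le _)
  intro p hp
  have hp0 : 0 < p := lt_of_le_of_lt (Nat.zero_le y) (Finset.mem_Ioc.mp hp).1
  exact Nat.pow_le_pow_right hp0 ((Nat.factorization_le_iff_dvd ha hb).mpr h p)

/-- `∏_{p ∣ N} (p² − 1) ≤ N²` for `N ≠ 0`. [folklore] -/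
theorem prod_primeFactors_sq_sub_one_le {N : ℕ} (hN : N ≠ 0) :
    ∏ p ∈ N.primeFactors, (p ^ 2 - 1) ≤ N ^ 2 := by
  calc ∏ p ∈ N.primeFactors, (p ^ 2 - 1) ≤ ∏ p ∈ N.primeFactors, p ^ 2 :=
        Finset.prod_le_prod (fun _ _ => Nat.zero_le _) (fun p _ => Nat.sub_le _ _)
    _ = (∏ p ∈ N.primeFactors, p) ^ 2 := Finset.prod_pow _ _ _
    _ ≤ N ^ 2 := Nat.pow_le_pow_left (Nat.le_of_dvd (Nat.pos_of_ne_zero hN)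
        (Nat.prod_primeFactors_dvd N)) 2

/-- **First lemma of card `steinberg-selmer-cutoff` (composition, PROVED):** the two slices and
Pasten's valuation-product theorem give the smooth-part law, hence (previous theorem) crux B.
`[m]_L ≤ [m]_7 · window(7,L]`; apply `EisensteinSliceBound` below the datum produced by
`IrreducibleCutoffLaw` (divisibilities compose; the window part is monotone under divisibility);
bound `valuationProduct W < K_1 N^{13/2}` (ε = 1) and `∏_{p∣N}(p²−1) ≤ N²`. [folklore] -/
theorem smoothPartLaw_of_slices (hI : IrreducibleCutoffLaw) (hE : EisensteinSliceBound)
    (hP : pasten_valuationProduct_semistable) : SmoothPartLaw := by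
  obtain ⟨κ₁, κ₂, C, hκ₁, hI⟩ := hI
  obtain ⟨κE, CE, hE⟩ := hE
  obtain ⟨K, hK, hPK⟩ := hP 1 one_pos
  refine ⟨κ₁, κE + κ₂ + ((11 : ℝ) / 2 + 1) + 2, max CE 0 * max C 0 * K, hκ₁, ?_⟩
  intro W _ _ _ hW D₀
  obtain ⟨D₁, hd₁, hI₁⟩ := hI W hW D₀
  obtain ⟨D₂, hd₂, hE₂⟩ := hE W hW D₁
  refine ⟨D₂, hd₂.trans hd₁, fun L hL => ?_⟩
  set N : ℕ := W.conductorNorm ℤ with hN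
  have hN0n : N ≠ 0 := NeZero.ne N
  have hN0 : (0 : ℝ) < N := by exact_mod_cast Nat.pos_of_ne_zero hN0n
  -- the pieces
  have hsplit : (smoothPart L D₂.modularDegree : ℝ) ≤
      (smoothPart 7 D₂.modularDegree : ℝ) * (windowPart 7 L D₂.modularDegree : ℝ) := by
    exact_mod_cast smoothPart_le_mul L D₂.modularDegree
  have hmono : (windowPart 7 L D₂.modularDegree : ℝ) ≤ (windowPart 7 L D₁.modularDegree : ℝ) := by
    exact_mod_cast windowPart_mono hd₂ D₁.deg_pos.ne'
  have hEis : (smoothPart 7 D₂.modularDegree : ℝ) ≤ max CE 0 * (N : ℝ) ^ κE :=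
    hE₂.trans (mul_le_mul_of_nonneg_right (le_max_left _ _) (Real.rpow_nonneg hN0.le _))
  have hT : ((valuationProduct W * ∏ p ∈ N.primeFactors, (p ^ 2 - 1) : ℕ) : ℝ) ≤
      K * (N : ℝ) ^ ((11 : ℝ) / 2 + 1) * (N : ℝ) ^ (2 : ℝ) := by
    have h1 : (valuationProduct W : ℝ) ≤ K * (N : ℝ) ^ ((11 : ℝ) / 2 + 1) := (hPK W hW).le
    have h2 : ((∏ p ∈ N.primeFactors, (p ^ 2 - 1) : ℕ) : ℝ) ≤ (N : ℝ) ^ (2 : ℝ) := by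
      rw [Real.rpow_two]
      exact_mod_cast prod_primeFactors_sq_sub_one_le hN0n
    rw [Nat.cast_mul]
    have h3 : (0 : ℝ) ≤ ((∏ p ∈ N.primeFactors, (p ^ 2 - 1) : ℕ) : ℝ) := by positivity
    have h4 : (0 : ℝ) ≤ K * (N : ℝ) ^ ((11 : ℝ) / 2 + 1) := by positivity
    calc (valuationProduct W : ℝ) * ((∏ p ∈ N.primeFactors, (p ^ 2 - 1) : ℕ) : ℝ)
        ≤ (K * (N : ℝ) ^ ((11 : ℝ) / 2 + 1)) * ((∏ p ∈ N.primeFactors, (p ^ 2 - 1) : ℕ) : ℝ) :=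
          mul_le_mul_of_nonneg_right h1 h3
      _ ≤ (K * (N : ℝ) ^ ((11 : ℝ) / 2 + 1)) * (N : ℝ) ^ (2 : ℝ) :=
          mul_le_mul_of_nonneg_left h2 h4
  have hLpos : (0 : ℝ) ≤ (L : ℝ) ^ κ₁ := Real.rpow_nonneg (Nat.cast_nonneg L) _
  have hWin : (windowPart 7 L D₁.modularDegree : ℝ) ≤
      max C 0 * (L : ℝ) ^ κ₁ * (N : ℝ) ^ κ₂ * (K * (N : ℝ) ^ ((11 : ℝ) / 2 + 1) * (N : ℝ) ^ (2 : ℝ)) := by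
    have h := hI₁ L hL
    have hT0 : (0 : ℝ) ≤ ((valuationProduct W * ∏ p ∈ N.primeFactors, (p ^ 2 - 1) : ℕ) : ℝ) := by
      positivity
    calc (windowPart 7 L D₁.modularDegree : ℝ)
        ≤ C * (L : ℝ) ^ κ₁ * (N : ℝ) ^ κ₂ *
            ((valuationProduct W * ∏ p ∈ N.primeFactors, (p ^ 2 - 1) : ℕ) : ℝ) := h
      _ ≤ max C 0 * (L : ℝ) ^ κ₁ * (N : ℝ) ^ κ₂ *
            ((valuationProduct W * ∏ p ∈ N.primeFactors, (p ^ 2 - 1) : ℕ) : ℝ) := by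
          apply mul_le_mul_of_nonneg_right _ hT0
          exact mul_le_mul_of_nonneg_right (mul_le_mul_of_nonneg_right (le_max_left _ _) hLpos)
            (Real.rpow_nonneg hN0.le _)
      _ ≤ max C 0 * (L : ℝ) ^ κ₁ * (N : ℝ) ^ κ₂ * (K * (N : ℝ) ^ ((11 : ℝ) / 2 + 1) * (N : ℝ) ^ (2 : ℝ)) := by
          apply mul_le_mul_of_nonneg_left hT
          exact mul_nonneg (mul_nonneg (le_max_right _ _) hLpos) (Real.rpow_nonneg hN0.le _)
  -- assemble
  have hE0 : (0 : ℝ) ≤ max CE 0 * (N : ℝ) ^ κE := mul_nonneg (le_max_right _ _) (Real.rpow_nonneg hN0.le _)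
  have hW0 : (0 : ℝ) ≤ (windowPart 7 L D₂.modularDegree : ℝ) := Nat.cast_nonneg _
  calc (smoothPart L D₂.modularDegree : ℝ)
      ≤ (smoothPart 7 D₂.modularDegree : ℝ) * (windowPart 7 L D₂.modularDegree : ℝ) := hsplit
    _ ≤ (max CE 0 * (N : ℝ) ^ κE) * (windowPart 7 L D₁.modularDegree : ℝ) :=
        mul_le_mul hEis hmono hW0 hE0
    _ ≤ (max CE 0 * (N : ℝ) ^ κE) *
          (max C 0 * (L : ℝ) ^ κ₁ * (N : ℝ) ^ κ₂ * (K * (N : ℝ) ^ ((11 : ℝ) / 2 + 1) * (N : ℝ) ^ (2 : ℝ))) :=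
        mul_le_mul_of_nonneg_left hWin hE0
    _ = max CE 0 * max C 0 * K * (L : ℝ) ^ κ₁ * (N : ℝ) ^ (κE + κ₂ + ((11 : ℝ) / 2 + 1) + 2) := by
        have hexp : (N : ℝ) ^ (κE + κ₂ + ((11 : ℝ) / 2 + 1) + 2) =
            (N : ℝ) ^ κE * (N : ℝ) ^ κ₂ * (N : ℝ) ^ ((11 : ℝ) / 2 + 1) * (N : ℝ) ^ (2 : ℝ) := by
          rw [Real.rpow_add hN0, Real.rpow_add hN0, Real.rpow_add hN0]
        rw [hexp]
        ring

/-- Hence the full line of cards 2 + 3 (PROVED composition, standard axioms):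
`IrreducibleCutoffLaw ∧ EisensteinSliceBound ∧ Pasten Thm 1.12 ⟹ crux B` by name. [folklore] -/
theorem polyDegreeOfBoundedPrimes_of_slices (hI : IrreducibleCutoffLaw) (hE : EisensteinSliceBound)
    (hP : pasten_valuationProduct_semistable) : PolyDegreeOfBoundedPrimes :=
  polyDegreeOfBoundedPrimes_of_smoothPartLaw (smoothPartLaw_of_slices hI hE hP)

/-! ## Per-prime form and the count residual (recorded for card 1's discussion) -/

/-- `A^e`: every PRIME POWER dividing the minimal modular degree is `≤ C N^κ` — the per-prime
case `L = ℓ` of the law; what the route's transcendence lever would give in prime-power form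
(`EllipticGluingPrimeBound` for prime powers, instance `B = J₀(N)`). -/
def DegreePrimePowersPolyBounded : Prop :=
  ∃ κ C : ℝ, ∀ (W : WeierstrassCurve ℚ) [W.IsElliptic] [W.IsGloballyMinimal]
    [NeZero (W.conductorNorm ℤ)], W.IsSemistable ℤ →
    ∃ D : ModularParametrizationData W (W.conductorNorm ℤ), ∀ ℓ : ℕ, ℓ.Prime →
      ((ℓ ^ (D.modularDegree).factorization ℓ : ℕ) : ℝ) ≤ C * (W.conductorNorm ℤ : ℝ) ^ κ

/-- **TruncatedMassLaw** (the COUNT residual): `Σ_{ℓ ∣ deg} min(v_ℓ(deg) log ℓ, log N) ≤ κ₃ log N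
+ C` for the minimal datum — "the modular degree has the prime-count profile of a typical integer
of polynomial size". `DegreePrimePowersPolyBounded ∧ TruncatedMassLaw ⟹ P` (each prime's full
contribution is `≤ (κ + o(1)) ·` its truncated contribution), but no tool for the count is known;
heuristic support only (Dickman/Mertens). -/
def TruncatedMassLaw : Prop :=
  ∃ κ₃ C : ℝ, ∀ (W : WeierstrassCurve ℚ) [W.IsElliptic] [W.IsGloballyMinimal]
    [NeZero (W.conductorNorm ℤ)], W.IsSemistable ℤ →
    ∀ D₀ : ModularParametrizationData W (W.conductorNorm ℤ),
      ∃ D : ModularParametrizationData W (W.conductorNorm ℤ),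
        D.modularDegree ∣ D₀.modularDegree ∧
        (∑ ℓ ∈ (D.modularDegree).primeFactors,
            min (((D.modularDegree).factorization ℓ : ℝ) * Real.log ℓ)
              (Real.log (W.conductorNorm ℤ : ℝ))) ≤
          κ₃ * Real.log (W.conductorNorm ℤ : ℝ) + C

end Summit.ABC.ABC.Cruxes.PolyDegreeOfBoundedPrimes.Ideator1

end
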